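import Mathlib
import HarnessLib
import Summits.AtomisticToContinuum.FouriersLaw.Theses.JunctionLocality
import Literature.MathematicalPhysics.KineticTheory.ChainReflection
import Literature.MathematicalPhysics.KineticTheory.PhaseSpacePoisson
import Summits.AtomisticToContinuum.FouriersLaw.Theorems.JunctionLocalitySuperadditiveResistanceKuboPlain
import Summits.AtomisticToContinuum.FouriersLaw.Theorems.JunctionLocalitySuperadditiveResistanceDeviceLineCalculus
import Summits.AtomisticToContinuum.FouriersLaw.Theorems.JunctionLocalitySuperadditiveResistanceStubTerminationLocalityTC
import Summits.AtomisticToContinuum.FouriersLaw.Theorems.JunctionLocalitySuperadditiveResistanceStubDeviceForwardFieldsAux5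
import Summits.AtomisticToContinuum.FouriersLaw.Theorems.JunctionLocalitySuperadditiveResistanceStubLinearResponsePlainAux2
import Summits.AtomisticToContinuum.FouriersLaw.Theorems.JunctionLocalityNonBallisticProfileUniformBound

/-!
# The far-contact identity: the end momentum-gradient of the plain chain's forward field is EXACTLY `Θ(√G_L)`
(helper `--supports` crux `JunctionLocality.SuperadditiveResistance`, stmt-AtomisticToContinuum-11748; line lead a1,
evaluation of line `Sketch` = idea `odd-committor-restriction`, 2026-08-16)

Pinned anharmonic chain `pinnedChain ω₂ lam β γ` (`ω₂, γ, T > 0`, `lam, β ≥ 0`), `L ≥ 1`, `g` a classical mean-zero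
`C² ∩ L²(μ_T)` forward field of the LEFT bath (`L_{T,T} g = −(p_0² − T)`), `A := ⟨g, p_0² − T⟩_{μ_T}`,
`G_L = γ(1 − (γ/T²)A)` (`KuboPlain.plainKubo`); norms in `L²(μ_T)`:
* `plainField_add_comp_siteReflection` — **the two forward fields sum to the energy**: `g + g ∘ R = (H − ⟨H⟩)/γ`
  (`R` = site reflection, `g ∘ R` is the right bath's forward field; uniqueness by the `L²(μ_T)`-Liouville theorem);
* `plainField_farGradient_sq_eq` — **far-contact identity** `‖∂_{p_{L−1}} g‖² = T/(2γ²) − A/(2γT)`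
  (`= T G_L/(2γ³)`, `plainField_farGradient_sq_eq_kubo`);
* `plainField_nearGradient_sq_eq` — `‖∂_{p_0} g‖² = 3A/(2γT) − T/(2γ²)` (`= T/γ² − 3T G_L/(2γ³)`);
* `plainField_farFluctGradient_sq_eq_kubo` — `‖∂_{p_{L−1}} g − (G_L/γ²) p_{L−1}‖² = (T G_L/γ³)(1/2 − G_L/γ)`.
Proof: `∂_{p_0}(g∘R) = (∂_{p_{L−1}} g)∘R`, `R_* μ_T = μ_T`, so `‖∂_{p_{L−1}} g‖² = ‖p_0/γ − ∂_{p_0} g‖²`; expand with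
`‖p_0‖² = T`, `⟨p_0, ∂_{p_0} g⟩ = A/T` (`Kubo.gauss_ibp`) and the carré du champ `γT(‖∂_{p_0} g‖² + ‖∂_{p_{L−1}} g‖²) = A`.

WHY RECORDED (`Cruxes/SuperadditiveResistance/Lines/Sketch.dead.md`): the landed `N`-uniform BUDGET
`plainField_endGradient_sq_le` (`‖∂_{p_{N−1}} g_N‖² ≤ (T/γ⁴)G_N(γ − G_N)`, `…StubTerminationLocalityAux9`) is an equality
up to the factor `2(γ − G)/γ ∈ [1, 2]`: the far-contact gradient of the forward field is EXACTLY of squared norm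
`T G_L/(2γ³) = Θ(G_L)` while its coherent part along `p_{L−1}` is `Θ(G_L²)`; as `G_L → 0` the incoherent remainder
dominates by `γ/(2G_L) − 1`. No sharpening of gradient budgets supplies the "one factor `√G` short" of the κ-frame legs,
and the odd-committor card's `JunctionOddField` (an `O(G²)` momentum-gradient bound at an UNDAMPED interior site) asks
one order more than what holds with equality at a damped contact. Standard axioms; nothing taken as a named fact.
-/

noncomputable section

open MeasureTheory Filter Topology
open scoped ContDiff
open Literature.MathematicalPhysics.KineticTheory.HeatConduction
open Summit.AtomisticToContinuum.FouriersLaw.Theorems.SuperadditiveResistance.DeviceLiouville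
  (kin kin_eq_sq liouvilleOp bathOp eq_zero_of_liouville_pinnedChain liouvilleOp_sub bathOp_sub partialP_sub)
open Summit.AtomisticToContinuum.FouriersLaw.Theorems.SuperadditiveResistance.Kubo
  (memLp_hamiltonian memLp_momentum memLp_kinetic memLp_partialP partition_pos gauss_ibp)
open Summit.AtomisticToContinuum.FouriersLaw.Theorems.SuperadditiveResistance.KuboPlain
  (plainForwardFields plainKubo generator_comp_siteReflection_left memLp_comp_siteReflection
    generator_eq_liouvilleOp_add_bathOp plainKubo_pos_and_le)
open Summit.AtomisticToContinuum.FouriersLaw.Cruxes.SuperadditiveResistance.ThermaliseThenCutProbeInsertion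
  (plainField_dirichlet plainField_projection plainField_endPairing integral_sub_proj_sq integral_sq_momentum
    memLp_partialP_plainField hamiltonian_bathWeight_pair)
open Summit.AtomisticToContinuum.FouriersLaw.Cruxes.SuperadditiveResistance.FloatingProbeBypassLaplacian
  (liouvilleOp_add' liouvilleOp_const_mul bathOp_add' bathOp_const_mul)
open Summit.AtomisticToContinuum.FouriersLaw.Theorems.NonBallistic (measurePreserving_siteReflection_gibbsMeasure)

namespace Summit.AtomisticToContinuum.FouriersLaw.Theorems.SuperadditiveResistance.FarContact

section Main

variable {ω₂ lam β γ : ℝ} {L : ℕ} {T : ℝ}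

/-- The reflected field's near-contact gradient is the original field's far-contact gradient, reflected:
`∂_{p_0}(g ∘ R)(x) = (∂_{p_{L−1}} g)(R x)`. [folklore] -/
theorem partialP_zero_comp_siteReflection (hL : 1 ≤ L) (g : PhaseSpace L → ℝ) (x : PhaseSpace L) :
    partialP ⟨0, by omega⟩ (g ∘ siteReflection L) x = partialP ⟨L - 1, by omega⟩ g (siteReflection L x) := by
  rw [partialP_comp_siteReflection, show Fin.rev (⟨0, by omega⟩ : Fin L) = ⟨L - 1, by omega⟩ from Fin.ext (Fin.val_rev _)]

/-- `X_H` kills constants. [folklore] -/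
theorem liouvilleOp_const (P : OscillatorChain) (L : ℕ) (c : ℝ) (x : PhaseSpace L) :
    liouvilleOp P L (fun _ => c) x = 0 := by
  unfold liouvilleOp
  exact Finset.sum_eq_zero fun i _ => by rw [partialP_const, partialQ_const]; ring

/-- `S_B` kills constants. [folklore] -/
theorem bathOp_const (L : ℕ) (B : Fin L → ℝ) (T c : ℝ) (x : PhaseSpace L) :
    bathOp L B T (fun _ => c) x = 0 := by
  unfold bathOp
  refine Finset.sum_eq_zero fun i _ => ?_
  rw [show partialP i (fun _ : PhaseSpace L => c) = fun _ => 0 from funext fun z => partialP_const c i z,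
    partialP_const]; ring

/-- The left bath weight is positive. [folklore] -/
theorem bathWeight_zero_pos (hL : 0 < L) : 0 < OscillatorChain.bathWeight L ⟨0, hL⟩ := by
  unfold OscillatorChain.bathWeight; simp only [if_true]; split_ifs <;> norm_num

/-- The classical pair form of the forward-field equation: `X_H g + γ S g = −(p_0² − T)`. [folklore] -/
theorem plainField_pair {g : PhaseSpace L → ℝ}
    (hgpde : ∀ x, (pinnedChain ω₂ lam β γ).generator L T T g x = -(kin L 0 x - T)) (y : PhaseSpace L) :
    1 * liouvilleOp (pinnedChain ω₂ lam β γ) L g y +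
        γ * bathOp L (OscillatorChain.bathWeight L) T g y = -(kin L 0 y - T) := by
  rw [← hgpde y, generator_eq_liouvilleOp_add_bathOp]
  have : (pinnedChain ω₂ lam β γ).γ = γ := rfl
  rw [this, one_mul]

/-- `∂_{p_0} g ∈ L²(μ_T)` for a classical forward field of the left bath (finite entropy production at the
source contact, `Kubo.memLp_partialP`). [folklore] -/
theorem memLp_partialP_zero_plainField (hω : 0 < ω₂) (hl : 0 ≤ lam) (hβ : 0 ≤ β) (hγ : 0 < γ)
    (hL : 0 < L) (hT : 0 < T) {g : PhaseSpace L → ℝ} (hgC : ContDiff ℝ 2 g)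
    (hgL2 : MemLp g 2 ((pinnedChain ω₂ lam β γ).gibbsMeasure L T))
    (hgpde : ∀ x, (pinnedChain ω₂ lam β γ).generator L T T g x = -(kin L 0 x - T)) :
    MemLp (partialP ⟨0, hL⟩ g) 2 ((pinnedChain ω₂ lam β γ).gibbsMeasure L T) := by
  have hk : MemLp (fun y : PhaseSpace L => kin L 0 y - T) 2 ((pinnedChain ω₂ lam β γ).gibbsMeasure L T) := by
    have e : (fun y : PhaseSpace L => kin L 0 y - T) = fun y => y.2 ⟨0, hL⟩ ^ 2 - T := by
      funext y; rw [kin_eq_sq hL]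
    rw [e]; exact memLp_kinetic (γ := γ) hω hl hβ L hT ⟨0, hL⟩
  exact memLp_partialP hω hl hβ γ L hT _ (fun i => by unfold OscillatorChain.bathWeight; split_ifs <;> norm_num) 1 hγ hgC hgL2 hk (plainField_pair hgpde)
    (bathWeight_zero_pos hL)

/-- **The two forward fields sum to the energy.** For a classical mean-zero forward field `g` of the left bath
of the plain `L`-chain (`L ≥ 1`), `g(x) + g(Rx) = (H(x) − ⟨H⟩_{μ_T})/γ` for every `x`: `γ(g + g ∘ R) − (H − ⟨H⟩)`
is a classical mean-zero `C² ∩ L²(μ_T)` solution of `X_H u + γ S u = 0` (`g ∘ R` is the right bath's forward field,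
`L_{T,T} H = −γ((p_0² − T) + (p_{L−1}² − T))`), hence vanishes by the Liouville theorem. [folklore] -/
theorem plainField_add_comp_siteReflection (hω : 0 < ω₂) (hl : 0 ≤ lam) (hβ : 0 ≤ β) (hγ : 0 < γ)
    (hL : 1 ≤ L) (hT : 0 < T) {g : PhaseSpace L → ℝ} (hgC : ContDiff ℝ 2 g)
    (hgL2 : MemLp g 2 ((pinnedChain ω₂ lam β γ).gibbsMeasure L T))
    (hmean : ∫ x, g x ∂((pinnedChain ω₂ lam β γ).gibbsMeasure L T) = 0)
    (hgpde : ∀ x, (pinnedChain ω₂ lam β γ).generator L T T g x = -(kin L 0 x - T)) (x : PhaseSpace L) :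
    g x + g (siteReflection L x) =
      ((pinnedChain ω₂ lam β γ).hamiltonian L x -
        ∫ y, (pinnedChain ω₂ lam β γ).hamiltonian L y ∂((pinnedChain ω₂ lam β γ).gibbsMeasure L T)) / γ := by
  set P := pinnedChain ω₂ lam β γ with hP
  set μ := P.gibbsMeasure L T with hμ
  haveI := pinnedChain_isProbabilityMeasure_gibbsMeasure hω hl hβ γ L hT
  have hL0 : 0 < L := by omega
  have hγ' : P.γ = γ := rfl
  have hγ0 : γ ≠ 0 := hγ.ne'
  set EH : ℝ := ∫ y, P.hamiltonian L y ∂μ with hEH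
  -- the pieces
  set gR : PhaseSpace L → ℝ := g ∘ siteReflection L with hgR
  set Hf : PhaseSpace L → ℝ := P.hamiltonian L with hHf
  set s : PhaseSpace L → ℝ := g + gR with hs
  set m : PhaseSpace L → ℝ := fun y => γ * s y with hm
  set d : PhaseSpace L → ℝ := fun y => m y - Hf y with hd
  set w : PhaseSpace L → ℝ := fun y => d y - -EH with hw
  -- regularity
  have hHs : ContDiff ℝ 2 Hf :=
    (P.contDiff_hamiltonian (pinnedChain_contDiff_U ω₂ lam β γ) (pinnedChain_contDiff_V ω₂ lam β γ) L).of_le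
      (by norm_cast)
  have hHL2 : MemLp Hf 2 μ := memLp_hamiltonian hω hl hβ L hT
  have hRC : ContDiff ℝ 2 gR := hgC.comp contDiff_siteReflection
  have hRL2 : MemLp gR 2 μ := memLp_comp_siteReflection hω hl hβ hT hgC.continuous hgL2
  have hRpde : ∀ y, P.generator L T T gR y = -(kin L (L - 1) y - T) :=
    generator_comp_siteReflection_left ω₂ lam β γ T hL hgpde
  have hmR : MeasurePreserving (siteReflection L) μ μ :=
    measurePreserving_siteReflection_gibbsMeasure P (pinnedChain_V_neg ω₂ lam β γ) L T
  have hmeanR : ∫ y, gR y ∂μ = 0 := by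
    have := hmR.integral_comp (siteReflectionEquiv L).measurableEmbedding g
    show ∫ y, g (siteReflection L y) ∂μ = 0
    rw [this, hmean]
  have hsC : ContDiff ℝ 2 s := hgC.add hRC
  have hmC : ContDiff ℝ 2 m := contDiff_const.mul hsC
  have hdC : ContDiff ℝ 2 d := hmC.sub hHs
  have hwC : ContDiff ℝ 2 w := hdC.sub contDiff_const
  have hmL2 : MemLp m 2 μ := (hgL2.add hRL2).const_mul γ
  have hdL2 : MemLp d 2 μ := hmL2.sub hHL2
  have hwL2 : MemLp w 2 μ := hdL2.sub (memLp_const _)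
  -- mean zero
  have hIs : ∫ y, s y ∂μ = 0 := by
    show ∫ y, g y + gR y ∂μ = 0
    rw [integral_add (hgL2.integrable one_le_two) (hRL2.integrable one_le_two), hmean, hmeanR, add_zero]
  have hIm : ∫ y, m y ∂μ = 0 := by
    show ∫ y, γ * s y ∂μ = 0
    rw [integral_const_mul, hIs, mul_zero]
  have hId : ∫ y, d y ∂μ = -EH := by
    show ∫ y, m y - Hf y ∂μ = -EH
    rw [integral_sub (hmL2.integrable one_le_two) (hHL2.integrable one_le_two), hIm, zero_sub]
  have hwmean : ∫ y, w y ∂μ = 0 := by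
    show ∫ y, d y - -EH ∂μ = 0
    rw [integral_sub (hdL2.integrable one_le_two) (integrable_const _), hId, integral_const]
    simp
  -- the PDE `X_H w + γ S w = 0`
  have hwpde : ∀ y, 1 * liouvilleOp P L w y + γ * bathOp L (OscillatorChain.bathWeight L) T w y = 0 := by
    intro y
    have eg := plainField_pair hgpde y
    have eR : 1 * liouvilleOp P L gR y + γ * bathOp L (OscillatorChain.bathWeight L) T gR y =
        -(kin L (L - 1) y - T) := by
      rw [← hRpde y, generator_eq_liouvilleOp_add_bathOp, hγ', one_mul]
    have eH := hamiltonian_bathWeight_pair P hL0 T 1 y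
    rw [hγ'] at eH
    -- linearity, Liouville part
    have hXw : liouvilleOp P L w y = liouvilleOp P L d y - liouvilleOp P L (fun _ => -EH) y :=
      liouvilleOp_sub (f := d) (g := fun _ => -EH) (hdC.differentiable two_ne_zero) (differentiable_const _) y
    have hXd : liouvilleOp P L d y = liouvilleOp P L m y - liouvilleOp P L Hf y :=
      liouvilleOp_sub (f := m) (g := Hf) (hmC.differentiable two_ne_zero) (hHs.differentiable two_ne_zero) y
    have hXm : liouvilleOp P L m y = γ * liouvilleOp P L s y := liouvilleOp_const_mul P γ s y
    have hXs : liouvilleOp P L s y = liouvilleOp P L g y + liouvilleOp P L gR y :=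
      liouvilleOp_add' P (hgC.differentiable two_ne_zero) (hRC.differentiable two_ne_zero) y
    -- bath part
    have hSw : bathOp L (OscillatorChain.bathWeight L) T w y =
        bathOp L (OscillatorChain.bathWeight L) T d y - bathOp L (OscillatorChain.bathWeight L) T (fun _ => -EH) y :=
      bathOp_sub (f := d) (g := fun _ => -EH) hdC contDiff_const _ T y
    have hSd : bathOp L (OscillatorChain.bathWeight L) T d y =
        bathOp L (OscillatorChain.bathWeight L) T m y - bathOp L (OscillatorChain.bathWeight L) T Hf y :=
      bathOp_sub (f := m) (g := Hf) hmC hHs _ T y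
    have hSm : bathOp L (OscillatorChain.bathWeight L) T m y = γ * bathOp L (OscillatorChain.bathWeight L) T s y :=
      bathOp_const_mul γ s _ T y
    have hSs : bathOp L (OscillatorChain.bathWeight L) T s y =
        bathOp L (OscillatorChain.bathWeight L) T g y + bathOp L (OscillatorChain.bathWeight L) T gR y :=
      bathOp_add' hgC hRC _ T y
    rw [hXw, hXd, hXm, hXs, hSw, hSd, hSm, hSs, liouvilleOp_const, bathOp_const]
    have k0 : kin L 0 y = y.2 ⟨0, hL0⟩ ^ 2 := kin_eq_sq hL0 y
    have k1 : kin L (L - 1) y = y.2 ⟨L - 1, Nat.sub_lt hL0 one_pos⟩ ^ 2 := kin_eq_sq (Nat.sub_lt hL0 one_pos) y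
    rw [k0] at eg
    rw [k1] at eR
    linear_combination γ * eg + γ * eR - eH
  have hzero := eq_zero_of_liouville_pinnedChain hω hl hβ γ hL0 hT (OscillatorChain.bathWeight L)
    (fun i => by unfold OscillatorChain.bathWeight; split_ifs <;> norm_num) (bathWeight_zero_pos hL0) one_ne_zero hγ hwC hwL2 hwpde hwmean x
  have hwx : w x = γ * (g x + g (siteReflection L x)) - Hf x - -EH := rfl
  rw [hwx] at hzero
  rw [eq_div_iff hγ0]
  linear_combination hzero

/-- **The far-contact identity** (Kubo-pairing form). For a classical mean-zero forward field `g` of the left bath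
of the plain `L`-chain (`L ≥ 1`; `A = ⟨g, p_0² − T⟩_{μ_T}`):
`‖∂_{p_{L−1}} g‖²_{L²(μ_T)} = T/(2γ²) − A/(2γT)`. [folklore] -/
theorem plainField_farGradient_sq_eq (hω : 0 < ω₂) (hl : 0 ≤ lam) (hβ : 0 ≤ β) (hγ : 0 < γ)
    (hL : 1 ≤ L) (hT : 0 < T) {g : PhaseSpace L → ℝ} (hgC : ContDiff ℝ 2 g)
    (hgL2 : MemLp g 2 ((pinnedChain ω₂ lam β γ).gibbsMeasure L T))
    (hmean : ∫ x, g x ∂((pinnedChain ω₂ lam β γ).gibbsMeasure L T) = 0)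
    (hgpde : ∀ x, (pinnedChain ω₂ lam β γ).generator L T T g x = -(kin L 0 x - T)) :
    ∫ x, partialP ⟨L - 1, by omega⟩ g x ^ 2 ∂((pinnedChain ω₂ lam β γ).gibbsMeasure L T) =
      T / (2 * γ ^ 2) - 1 / (2 * γ * T) * ∫ x, g x * (kin L 0 x - T) ∂((pinnedChain ω₂ lam β γ).gibbsMeasure L T) := by
  set P := pinnedChain ω₂ lam β γ with hP
  set μ := P.gibbsMeasure L T with hμ
  haveI := pinnedChain_isProbabilityMeasure_gibbsMeasure hω hl hβ γ L hT
  have hL0 : 0 < L := by omega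
  have hγ0 : γ ≠ 0 := hγ.ne'
  have hT0 : T ≠ 0 := hT.ne'
  set A : ℝ := ∫ x, g x * (kin L 0 x - T) ∂μ with hA
  have hdir := plainField_dirichlet hω hl hβ hγ hL hT hgC hgL2 hgpde
  have hmR : MeasurePreserving (siteReflection L) μ μ :=
    measurePreserving_siteReflection_gibbsMeasure P (pinnedChain_V_neg ω₂ lam β γ) L T
  have hd0 : MemLp (partialP ⟨0, hL0⟩ g) 2 μ := memLp_partialP_zero_plainField hω hl hβ hγ hL0 hT hgC hgL2 hgpde
  -- (1) reflect: ‖∂_{p_{L-1}} g‖² = ‖∂_{p_0}(g∘R)‖²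
  have hrefl : ∫ x, partialP ⟨L - 1, by omega⟩ g x ^ 2 ∂μ =
      ∫ x, partialP ⟨0, hL0⟩ (g ∘ siteReflection L) x ^ 2 ∂μ := by
    have := hmR.integral_comp (siteReflectionEquiv L).measurableEmbedding
      (fun y => partialP ⟨L - 1, by omega⟩ g y ^ 2)
    rw [← this]
    refine integral_congr_ae (ae_of_all _ fun x => ?_)
    show partialP ⟨L - 1, _⟩ g (siteReflection L x) ^ 2 = partialP ⟨0, hL0⟩ (g ∘ siteReflection L) x ^ 2
    rw [partialP_zero_comp_siteReflection hL]
  -- (2) pointwise: ∂_{p_0}(g∘R) = p_0/γ − ∂_{p_0} g, from `g + g∘R = (H − EH)/γ`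
  have hsum := plainField_add_comp_siteReflection hω hl hβ hγ hL hT hgC hgL2 hmean hgpde
  have hHd : Differentiable ℝ (P.hamiltonian L) :=
    ((P.contDiff_hamiltonian (pinnedChain_contDiff_U ω₂ lam β γ) (pinnedChain_contDiff_V ω₂ lam β γ) L).of_le
      (by norm_cast : (2 : WithTop ℕ∞) ≤ ∞)).differentiable two_ne_zero
  have hgd : Differentiable ℝ g := hgC.differentiable two_ne_zero
  set EH : ℝ := ∫ z, P.hamiltonian L z ∂μ with hEH
  set F : PhaseSpace L → ℝ := fun y => γ⁻¹ * P.hamiltonian L y with hF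
  have hFd : Differentiable ℝ F := hHd.const_mul _
  set F2 : PhaseSpace L → ℝ := fun y => F y - g y with hF2
  have hF2d : Differentiable ℝ F2 := hFd.sub hgd
  have hpt : ∀ x, partialP ⟨0, hL0⟩ (g ∘ siteReflection L) x = x.2 ⟨0, hL0⟩ / γ - partialP ⟨0, hL0⟩ g x := by
    intro x
    have e : (g ∘ siteReflection L) = fun y => F2 y - EH / γ := by
      funext y
      have := hsum y
      simp only [Function.comp_apply, hF2, hF]
      rw [sub_div] at this
      linear_combination this
    rw [e, partialP_sub (f := F2) (g := fun _ => EH / γ) hF2d (differentiable_const _), partialP_const, sub_zero,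
      hF2, partialP_sub (f := F) (g := g) hFd hgd, hF, partialP_const_mul, P.partialP_hamiltonian]
    field_simp
  -- (3) expand the square
  have hexp : ∫ x, partialP ⟨0, hL0⟩ (g ∘ siteReflection L) x ^ 2 ∂μ =
      (∫ x, partialP ⟨0, hL0⟩ g x ^ 2 ∂μ) - 2 * (1 / γ) * (∫ x, x.2 ⟨0, hL0⟩ * partialP ⟨0, hL0⟩ g x ∂μ) +
        (1 / γ) ^ 2 * T := by
    rw [← integral_sub_proj_sq (γ := γ) hω hl hβ hT ⟨0, hL0⟩ hd0 (1 / γ)]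
    refine integral_congr_ae (ae_of_all _ fun x => ?_)
    show partialP ⟨0, hL0⟩ (g ∘ siteReflection L) x ^ 2 = (partialP ⟨0, hL0⟩ g x - 1 / γ * x.2 ⟨0, hL0⟩) ^ 2
    rw [hpt x]; ring
  -- (4) Gaussian integration by parts at the near contact: ⟨p_0, ∂_{p_0} g⟩ = A/T
  have hproj0 : ∫ x, x.2 ⟨0, hL0⟩ * partialP ⟨0, hL0⟩ g x ∂μ = 1 / T * A := by
    have h := gauss_ibp hω hl hβ L hT ⟨0, hL0⟩ (hgC.of_le (by norm_cast)) hgL2 hd0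
    rw [hA, P.integral_gibbsMeasure, P.integral_gibbsMeasure]
    have e1 : ∫ x, g x * (kin L 0 x - T) * P.gibbsDensity L T x =
        ∫ x, (x.2 ⟨0, hL0⟩ ^ 2 - T) * g x * P.gibbsDensity L T x :=
      integral_congr_ae (ae_of_all _ fun x => by dsimp only; rw [kin_eq_sq hL0]; ring)
    rw [e1, h]
    have hP' : pinnedChain ω₂ lam β γ = P := rfl
    simp only [hP']
    field_simp
  -- (5) combine with the carré du champ
  set X0 : ℝ := ∫ x, partialP ⟨0, hL0⟩ g x ^ 2 ∂μ with hX0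
  set X1 : ℝ := ∫ x, partialP ⟨0, hL0⟩ (g ∘ siteReflection L) x ^ 2 ∂μ with hX1
  have hdir' : γ * T * (X0 + ∫ x, partialP ⟨L - 1, by omega⟩ g x ^ 2 ∂μ) = A := hdir
  rw [hrefl] at hdir' ⊢
  have hsumX : X0 + X1 = A / (γ * T) := by
    rw [eq_div_iff (mul_ne_zero hγ0 hT0)]
    linear_combination hdir'
  have hdiff : X1 - X0 = T / γ ^ 2 - 2 * A / (γ * T) := by
    rw [hexp, hproj0]; ring
  linear_combination (1 / 2 : ℝ) * hsumX + (1 / 2 : ℝ) * hdiff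

/-- **The near-contact identity** (Kubo-pairing form): `‖∂_{p_0} g‖²_{L²(μ_T)} = 3A/(2γT) − T/(2γ²)`. [folklore] -/
theorem plainField_nearGradient_sq_eq (hω : 0 < ω₂) (hl : 0 ≤ lam) (hβ : 0 ≤ β) (hγ : 0 < γ)
    (hL : 1 ≤ L) (hT : 0 < T) {g : PhaseSpace L → ℝ} (hgC : ContDiff ℝ 2 g)
    (hgL2 : MemLp g 2 ((pinnedChain ω₂ lam β γ).gibbsMeasure L T))
    (hmean : ∫ x, g x ∂((pinnedChain ω₂ lam β γ).gibbsMeasure L T) = 0)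
    (hgpde : ∀ x, (pinnedChain ω₂ lam β γ).generator L T T g x = -(kin L 0 x - T)) :
    ∫ x, partialP ⟨0, by omega⟩ g x ^ 2 ∂((pinnedChain ω₂ lam β γ).gibbsMeasure L T) =
      3 / (2 * γ * T) * (∫ x, g x * (kin L 0 x - T) ∂((pinnedChain ω₂ lam β γ).gibbsMeasure L T)) -
        T / (2 * γ ^ 2) := by
  have hγ0 : γ ≠ 0 := hγ.ne'
  have hT0 : T ≠ 0 := hT.ne'
  have hdir := plainField_dirichlet hω hl hβ hγ hL hT hgC hgL2 hgpde
  have hfar := plainField_farGradient_sq_eq hω hl hβ hγ hL hT hgC hgL2 hmean hgpde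
  set A : ℝ := ∫ x, g x * (kin L 0 x - T) ∂((pinnedChain ω₂ lam β γ).gibbsMeasure L T) with hA
  set X0 : ℝ := ∫ x, partialP ⟨0, by omega⟩ g x ^ 2 ∂((pinnedChain ω₂ lam β γ).gibbsMeasure L T) with hX0
  set X1 : ℝ := ∫ x, partialP ⟨L - 1, by omega⟩ g x ^ 2 ∂((pinnedChain ω₂ lam β γ).gibbsMeasure L T) with hX1
  have hdir' : γ * T * (X0 + X1) = A := hdir
  have hsumX : X0 + X1 = A / (γ * T) := by
    rw [eq_div_iff (mul_ne_zero hγ0 hT0)]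
    linear_combination hdir'
  linear_combination hsumX - hfar

end Main

/-! ## Conductance form, for the line's Set-valued vocabulary -/
section Kubo

variable {ω₂ lam β γ T : ℝ} {L : ℕ}

/-- The Kubo pairing in terms of the conductance: `A = (T²/γ²)(γ − G_L)` (definition of `plainKubo`). [folklore] -/
theorem pairing_eq_of_plainKubo (hγ : 0 < γ) (hT : 0 < T) (g : PhaseSpace L → ℝ) :
    ∫ x, g x * (kin L 0 x - T) ∂((pinnedChain ω₂ lam β γ).gibbsMeasure L T) =
      T ^ 2 / γ ^ 2 * (γ - plainKubo ω₂ lam β γ T L g) := by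
  have hγ0 : γ ≠ 0 := hγ.ne'
  have hT0 : T ≠ 0 := hT.ne'
  unfold plainKubo
  field_simp
  ring

/-- **Far-contact identity, conductance form.** For the pinned anharmonic chain (all parameters `> 0`), `T > 0`,
`L ≥ 2` and every `g ∈ plainForwardFields … L`: `‖∂_{p_{L−1}} g‖²_{L²(μ_T)} = T G_L/(2γ³)`,
`G_L = plainKubo … g` — the far-contact entropy production of the forward field is EXACTLY `γT·‖∂_{p_{L−1}} g‖² =
T² G_L/(2γ²)`; in particular the landed budget `‖∂_{p_{L−1}} g‖² ≤ (T/γ⁴)G_L(γ − G_L)` is sharp up to the factor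
`2(γ − G_L)/γ ∈ [1, 2]`. [folklore] -/
theorem plainField_farGradient_sq_eq_kubo (hω : 0 < ω₂) (hl : 0 < lam) (hβ : 0 < β) (hγ : 0 < γ) (hT : 0 < T)
    (hL : 2 ≤ L) {g : PhaseSpace L → ℝ} (hg : g ∈ plainForwardFields ω₂ lam β γ T L) :
    ∫ x, partialP ⟨L - 1, by omega⟩ g x ^ 2 ∂((pinnedChain ω₂ lam β γ).gibbsMeasure L T) =
      T * plainKubo ω₂ lam β γ T L g / (2 * γ ^ 3) := by
  obtain ⟨hgC, hgL2, hmean, hgpde⟩ := hg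
  have hγ0 : γ ≠ 0 := hγ.ne'
  have hT0 : T ≠ 0 := hT.ne'
  rw [plainField_farGradient_sq_eq hω hl.le hβ.le hγ (by omega) hT hgC hgL2 hmean hgpde,
    pairing_eq_of_plainKubo hγ hT g]
  field_simp
  ring

/-- **The incoherent part of the far-contact gradient, exactly.** The component of `∂_{p_{L−1}} g` along `p_{L−1}`
is `(G_L/γ²) p_{L−1}` (`plainField_projection` + the far-end sum rule), and the orthogonal remainder has
`‖∂_{p_{L−1}} g − (G_L/γ²) p_{L−1}‖²_{L²(μ_T)} = (T G_L/γ³)(1/2 − G_L/γ)`: for small `G_L` it carries all of the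
far-contact gradient but the fraction `2G_L/γ`. (Non-negativity of the left side is the contact bound `G_L ≤ γ/2`,
landed as `plainKubo_le_half`.) [folklore] -/
theorem plainField_farFluctGradient_sq_eq_kubo (hω : 0 < ω₂) (hl : 0 < lam) (hβ : 0 < β) (hγ : 0 < γ)
    (hT : 0 < T) (hL : 2 ≤ L) {g : PhaseSpace L → ℝ} (hg : g ∈ plainForwardFields ω₂ lam β γ T L) :
    ∫ x, (partialP ⟨L - 1, by omega⟩ g x - plainKubo ω₂ lam β γ T L g / γ ^ 2 * x.2 ⟨L - 1, by omega⟩) ^ 2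
        ∂((pinnedChain ω₂ lam β γ).gibbsMeasure L T) =
      T * plainKubo ω₂ lam β γ T L g / γ ^ 3 * (1 / 2 - plainKubo ω₂ lam β γ T L g / γ) := by
  have hfar := plainField_farGradient_sq_eq_kubo hω hl hβ hγ hT hL hg
  obtain ⟨hgC, hgL2, hmean, hgpde⟩ := hg
  have hL1 : 1 ≤ L := by omega
  have hγ0 : γ ≠ 0 := hγ.ne'
  have hT0 : T ≠ 0 := hT.ne'
  set G := plainKubo ω₂ lam β γ T L g with hG
  have hd1 := memLp_partialP_plainField hω hl.le hβ.le hγ hL1 hT hgC hgL2 hgpde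
  have hpyth := integral_sub_proj_sq (γ := γ) hω hl.le hβ.le hT ⟨L - 1, by omega⟩ hd1 (G / γ ^ 2)
  have hproj : ∫ y, y.2 ⟨L - 1, by omega⟩ * partialP ⟨L - 1, by omega⟩ g y ∂((pinnedChain ω₂ lam β γ).gibbsMeasure L T) =
      1 / T * ∫ y, g y * (kin L (L - 1) y - T) ∂((pinnedChain ω₂ lam β γ).gibbsMeasure L T) :=
    plainField_projection hω hl.le hβ.le hγ hL1 hT hgC hgL2 hgpde
  have hend : ∫ y, g y * (kin L (L - 1) y - T) ∂((pinnedChain ω₂ lam β γ).gibbsMeasure L T) =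
      T ^ 2 / γ - ∫ y, g y * (kin L 0 y - T) ∂((pinnedChain ω₂ lam β γ).gibbsMeasure L T) :=
    plainField_endPairing hω hl.le hβ hγ hL1 hT hgC hgL2 hgpde
  rw [pairing_eq_of_plainKubo hγ hT g, ← hG] at hend
  have hproj' : ∫ y, y.2 ⟨L - 1, by omega⟩ * partialP ⟨L - 1, by omega⟩ g y ∂((pinnedChain ω₂ lam β γ).gibbsMeasure L T) =
      T / γ ^ 2 * G := by
    rw [hproj, hend]
    field_simp
    ring
  rw [hpyth, hproj', hfar]
  field_simp
  ring

/-- **Registered helper `helper_farContactIdentity`** (crux stmt-AtomisticToContinuum-11748): for `g ∈ plainForwardFields … L`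
(`L ≥ 2`, all parameters `> 0`): `‖∂_{p_{L−1}} g‖² = T G_L/(2γ³)` and `‖∂_{p_{L−1}} g − (G_L/γ²)p_{L−1}‖² = (T G_L/γ³)(1/2 − G_L/γ)`. -/
theorem helper_farContactIdentity : ∀ (ω₂ lam β γ T : ℝ), 0 < ω₂ → 0 < lam → 0 < β → 0 < γ → 0 < T → ∀ (L : ℕ) (hL : 2 ≤ L) (g : PhaseSpace L → ℝ), g ∈ plainForwardFields ω₂ lam β γ T L → (∫ x, partialP ⟨L - 1, by omega⟩ g x ^ 2 ∂((pinnedChain ω₂ lam β γ).gibbsMeasure L T)) = T * plainKubo ω₂ lam β γ T L g / (2 * γ ^ 3) ∧ (∫ x, (partialP ⟨L - 1, by omega⟩ g x - plainKubo ω₂ lam β γ T L g / γ ^ 2 * x.2 ⟨L - 1, by omega⟩) ^ 2 ∂((pinnedChain ω₂ lam β γ).gibbsMeasure L T)) = T * plainKubo ω₂ lam β γ T L g / γ ^ 3 * (1 / 2 - plainKubo ω₂ lam β γ T L g / γ) := by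
  intro ω₂ lam β γ T hω hl hβ hγ hT L hL g hg
  exact ⟨plainField_farGradient_sq_eq_kubo hω hl hβ hγ hT hL hg,
    plainField_farFluctGradient_sq_eq_kubo hω hl hβ hγ hT hL hg⟩

end Kubo

end Summit.AtomisticToContinuum.FouriersLaw.Theorems.SuperadditiveResistance.FarContact

end
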